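import Literature.NumberTheory.LFunctions.DeBruijnNewman
import Literature.NumberTheory.LFunctions.RiemannXi
import Mathlib.NumberTheory.LSeries.Deriv
import Mathlib.NumberTheory.LSeries.Dirichlet
import Mathlib.Analysis.SpecialFunctions.Gamma.Deriv
import HarnessLib

/-!
# Dobner's proof of Newman's conjecture: the deformed zeta function `ζ_t`, the map `J_t`,
and the approximation `ξ_t ∘ J_t ≈ γ_t · ζ_t` (named facts)

Trunk T-ANT (`Literature/NumberTheory/LFunctions`). Definitions and named facts (D-0014) for the
second, zero-statistics-free proof of Newman's conjecture `Λ ≥ 0` (the tree's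
`Literature.NumberTheory.LFunctions.rodgers_tao`, `Equivalents.lean`):

> A. Dobner, *A proof of Newman's conjecture for the extended Selberg class*, Acta Arith. 201
> (2021), 29–62 = arXiv:2005.05142 (held), **Thm. 2** (`Λ_F ≥ 0` for every `F` in the extended
> Selberg class; `F = ζ` is Newman's conjecture, first proved by Rodgers–Tao 2020).

Dobner shows directly that for every `t < 0` the deformed xi function `ξ_t` has zeros off the
critical line, from three ingredients, vendored here for `F = ζ` (§3 of the source):

* **Thm. 4** (steepest descent; §4): for `s = x + iy` in a vertical strip and `y → ∞`,
  `ξ_t(J_t(s)) = γ_t(s) (ζ_t(s) + o_{y→∞}(1))` uniformly in `x`, where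
  `ζ_t(s) = Σ_{n ≥ 1} e^{(t/4) log² n} n^{-s}`, `J_t(s) = s + (|t|/4) Log(s/2π)` and
  `γ_t(s) = γ(s) e^{(s − J_t(s))²/|t|}`, `γ(s) = ½ s(s−1) π^{-s/2} Γ(s/2)` — the named fact
  `Literature.NumberTheory.LFunctions.dobner_xiDeformed_approx` records the *qualitative version* displayed after Thm. 4, which
  is all that §3.1 uses;
* **Thm. 5** (H. Bohr 1922, Satz 1): almost periodicity of absolutely convergent Dirichlet
  series in vertical strips — `Literature.NumberTheory.LFunctions.bohr_almost_periodic`;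
* **Lemma 3** (§5, Hadamard factorisation in order `≤ 2`): `ζ_t` has a zero for every `t < 0` —
  `Literature.NumberTheory.LFunctions.dobner_zetaDeformed_exists_zero`.

The deduction "Thm. 4 + Thm. 5 + Lemma 3 ⇒ `Λ ≥ 0`" (§3.1 of the source: Bohr shifts, Rouché)
is **proved** in the companion file `DobnerNewmanProofs.lean` (`Literature.NumberTheory.LFunctions.rodgers_tao_of_dobner`),
with Hurwitz's theorem (`Literature/Analysis/Complex/Hurwitz.lean`) in place of Rouché.

## Definitions (namespace `Literature`)

* `Literature.zetaDeformed t` — `ζ_t(s) = Σ_{n≥1} e^{(t/4) log² n} n^{-s}` as an `LSeries`; for `t < 0`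
  it converges absolutely everywhere (`Literature.NumberTheory.LFunctions.zetaDeformed_summable`), and `ζ_0 = ζ` on `Re s > 1`
  (`Literature.NumberTheory.LFunctions.zetaDeformed_zero_eq`);
* `Literature.dobnerJ t s = s + (|t|/4) Log(s/(2π))` (principal logarithm);
* `Literature.xiGammaFactor s = ½ s(s−1) Γ_ℝ(s)` (`Γ_ℝ(s) = π^{-s/2} Γ(s/2)`, Mathlib's `Complex.Gammaℝ`),
  so that `ξ = γ · ζ` (`Literature.NumberTheory.LFunctions.xiGammaFactor_mul_riemannZeta`);
* `Literature.dobnerGammaT t s = γ(s) exp((s − J_t(s))²/|t|)`;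
* `Literature.xiDeformed t w = 8 H_t(−i(2w − 1))` — Dobner's `ξ_t`, defined in the source by
  `ξ_t((1+iz)/2) = ∫_ℝ e^{tu²} Φ_D(u) e^{izu} du` with `Φ_D = 4Φ` (`Φ = Literature.deBruijnPhi`, the
  Rodgers–Tao normalisation), i.e. `ξ_t((1+iz)/2) = 8 H_t(z)` (`H_t = Literature.deBruijnH t`, even
  integrand); at `t = 0`, `ξ_0 = ξ` (`Literature.NumberTheory.LFunctions.xiDeformed_zero_eq`, from `Literature.NumberTheory.LFunctions.deBruijnH_zero_eq`).
  Zeros of `ξ_t` off the critical line are zeros of `H_t` off the real axis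
  (`Literature.NumberTheory.LFunctions.xiDeformed_eq_zero_iff`).

## References

* A. Dobner, *A proof of Newman's conjecture for the extended Selberg class*, Acta Arith. 201
  (2021), 29–62; arXiv:2005.05142: §1 (eq. for `ξ_t`, `Φ`), §3 (eq. (3.1), Thm. 4 and the
  qualitative version following it, Thm. 5, §3.1, Lemma 3).
* H. Bohr, *Über eine quasi-periodische Eigenschaft Dirichletscher Reihen mit Anwendung auf die
  Dirichletschen `L`-Funktionen*, Math. Ann. 85 (1922), 115–122, Satz 1.
* B. Rodgers, T. Tao, *The de Bruijn–Newman constant is non-negative*, Forum Math. Pi 8 (2020),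
  e6, §1 eq. (1)–(3) (`H_t`, `Φ`, `H_0 = ξ(½ + iz/2)/8`).
-/

noncomputable section

open Complex Filter Set Topology

namespace Literature.NumberTheory.LFunctions

/-! ## The deformed zeta function `ζ_t` -/

/-- The coefficients `e^{(t/4) log² n}` of Dobner's deformed zeta function. [cite: Dobner2021, Thm. 4] -/
def zetaDeformedCoeff (t : ℝ) (n : ℕ) : ℂ :=
  (Real.exp (t / 4 * Real.log n ^ 2) : ℂ)

/-- Dobner's deformed zeta function `ζ_t(s) = Σ_{n ≥ 1} exp((t/4) log² n) n^{-s}` (the source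
writes `exp(−(|t|/4) log² n)` for `t < 0`), as an `LSeries`. For `t < 0` the series converges
absolutely for every `s` (`zetaDeformed_summable`); `ζ_0 = ζ` on `Re s > 1`.
[cite: Dobner2021, Thm. 4] -/
def zetaDeformed (t : ℝ) (s : ℂ) : ℂ :=
  LSeries (zetaDeformedCoeff t) s

/-- Unfolding lemma for `ζ_t`. [folklore] -/
theorem zetaDeformed_eq (t : ℝ) (s : ℂ) :
    zetaDeformed t s = LSeries (zetaDeformedCoeff t) s := rfl

/-- `ζ_0 = ζ` on the half-plane of absolute convergence `Re s > 1`. [cite: Dobner2021, §3] -/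
theorem zetaDeformed_zero_eq {s : ℂ} (hs : 1 < s.re) : zetaDeformed 0 s = riemannZeta s := by
  rw [zetaDeformed, ← LSeries_one_eq_riemannZeta hs]
  exact LSeries_congr (fun {n} _ ↦ by simp [zetaDeformedCoeff]) s

/-- For `t < 0`, the general term of `ζ_t` is eventually dominated by `n^{-2}`:
`‖e^{(t/4) log² n} n^{-s}‖ ≤ n^{-2}` as soon as `(|t|/4) log n ≥ Re s… + 2`. [folklore] -/
theorem norm_term_zetaDeformed_le {t : ℝ} (ht : t < 0) (s : ℂ) :
    ∀ᶠ n : ℕ in atTop, ‖LSeries.term (zetaDeformedCoeff t) s n‖ ≤ (n : ℝ) ^ (-2 : ℝ) := by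
  have hlog : Tendsto (fun n : ℕ ↦ Real.log n) atTop atTop :=
    Real.tendsto_log_atTop.comp tendsto_natCast_atTop_atTop
  filter_upwards [hlog.eventually_ge_atTop ((-s.re + 2) * (4 / -t)), eventually_ge_atTop 1]
    with n hn hn1
  have hn0 : (n : ℝ) ≠ 0 := by exact_mod_cast (show n ≠ 0 by omega)
  have hnpos : (0 : ℝ) < n := by exact_mod_cast (show 0 < n by omega)
  rw [LSeries.term_of_ne_zero (show n ≠ 0 by omega), norm_div, Complex.norm_natCast_cpow_of_pos
    (show 0 < n by omega), zetaDeformedCoeff, Complex.norm_real, Real.norm_eq_abs,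
    abs_of_pos (Real.exp_pos _), div_eq_mul_inv, ← Real.rpow_neg hnpos.le,
    Real.rpow_def_of_pos hnpos, Real.rpow_def_of_pos hnpos, ← Real.exp_add]
  apply Real.exp_le_exp.2
  have ht' : 0 < -t := by linarith
  have hL : 0 ≤ Real.log n := Real.log_nonneg (by exact_mod_cast hn1)
  -- `(t/4) L² + L (−Re s) ≤ −2 L` since `(−t/4) L ≥ −Re s + 2`
  have htne : t ≠ 0 := ht.ne
  have key : (-s.re + 2) ≤ -t / 4 * Real.log n := by
    have := mul_le_mul_of_nonneg_left hn (by linarith : (0 : ℝ) ≤ -t / 4)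
    rwa [show -t / 4 * ((-s.re + 2) * (4 / -t)) = -s.re + 2 by field_simp] at this
  nlinarith

/-- For `t < 0`, `ζ_t` converges absolutely at every `s`. [cite: Dobner2021, §3.1] -/
theorem zetaDeformed_summable {t : ℝ} (ht : t < 0) (s : ℂ) :
    LSeriesSummable (zetaDeformedCoeff t) s := by
  refine Summable.of_norm_bounded_eventually_nat
    ((Real.summable_nat_rpow.2 (by norm_num : (-2 : ℝ) < -1))) ?_
  exact norm_term_zetaDeformed_le ht s

/-- For `t < 0`, the abscissa of absolute convergence of `ζ_t` is `−∞`. [cite: Dobner2021, §3.1] -/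
theorem abscissaOfAbsConv_zetaDeformed {t : ℝ} (ht : t < 0) :
    LSeries.abscissaOfAbsConv (zetaDeformedCoeff t) = ⊥ := by
  refine le_antisymm ?_ bot_le
  refine LSeries.abscissaOfAbsConv_le_of_forall_lt_LSeriesSummable' fun x _ ↦ ?_
  exact zetaDeformed_summable ht x

/-- For `t < 0`, `ζ_t` is an entire function. [cite: Dobner2021, §3.1] -/
theorem differentiable_zetaDeformed {t : ℝ} (ht : t < 0) : Differentiable ℂ (zetaDeformed t) := by
  intro s
  have h := LSeries_differentiableOn (zetaDeformedCoeff t) s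
    (by rw [mem_setOf_eq, abscissaOfAbsConv_zetaDeformed ht]; exact EReal.bot_lt_coe _)
  exact h.differentiableAt ((isOpen_re_gt_EReal _).mem_nhds
    (by rw [mem_setOf_eq, abscissaOfAbsConv_zetaDeformed ht]; exact EReal.bot_lt_coe _))

/-! ## `J_t`, `γ`, `γ_t` and `ξ_t` -/

/-- Dobner's change of coordinates `J_t(s) = s + (|t|/4) Log(s/(2π))` (principal logarithm; for
`F = ζ`: `Q = π^{-1/2}`, `k = 1`, `ω₁ = ½`, so `(|t|/2) log Q + (|t|/2) ω₁ Log(ω₁ s)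
= (|t|/4) Log(s/(2π))`). [cite: Dobner2021, Thm. 4] -/
def dobnerJ (t : ℝ) (s : ℂ) : ℂ :=
  s + (|t| / 4 : ℝ) * Complex.log (s / (2 * Real.pi))

/-- The gamma factor `γ(s) = ½ s (s − 1) π^{-s/2} Γ(s/2) = ½ s(s−1) Γ_ℝ(s)` of `ξ = γ ζ`
(Dobner's `γ` for `F = ζ`: `α = ½`, `m = 1`, `Q = π^{-1/2}`, `ω₁ = ½`, `μ₁ = 0`).
[cite: Dobner2021, §2 (iii)] -/
def xiGammaFactor (s : ℂ) : ℂ :=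
  s * (s - 1) / 2 * Gammaℝ s

/-- `ξ(s) = γ(s) ζ(s)` away from `s = 1` and from the poles `0, −2, −4, …` of `Γ_ℝ` (where
Mathlib's junk values `Γ_ℝ = 0`, `ζ(−2n) = 0` break the identity, `ξ` being non-zero there); in
particular on the open upper half-plane. [cite: Dobner2021, §2 (iii)] -/
theorem xiGammaFactor_mul_riemannZeta {s : ℂ} (hs1 : s ≠ 1) (hG : Gammaℝ s ≠ 0) :
    xiGammaFactor s * riemannZeta s = riemannXi s := by
  have hs0 : s ≠ 0 := by
    rintro rfl
    exact hG (Gammaℝ_eq_zero_iff.2 ⟨0, by simp⟩)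
  rw [xiGammaFactor, riemannXi_eq_mul_completedRiemannZeta hs0 hs1,
    riemannZeta_def_of_ne_zero hs0]
  field_simp

/-- Dobner's `γ_t(s) = γ(s) exp((s − J_t(s))²/|t|)` (`= γ(s) exp((|t|/16) Log²(s/(2π)))`).
[cite: Dobner2021, Thm. 4] -/
def dobnerGammaT (t : ℝ) (s : ℂ) : ℂ :=
  xiGammaFactor s * Complex.exp ((1 / |t| : ℝ) * (s - dobnerJ t s) ^ 2)

/-- Dobner's deformed xi function `ξ_t`, defined in the source by
`ξ_t((1 + iz)/2) = ∫_ℝ e^{tu²} Φ_D(u) e^{izu} du` with `Φ_D = 4Φ` (`Φ = Literature.deBruijnPhi`); since the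
integrand is even in `u` this is `8 ∫₀^∞ e^{tu²} Φ(u) cos(zu) du = 8 H_t(z)`, and `w = (1+iz)/2`
means `z = −i(2w − 1)`. So `ξ_t(w) := 8 H_t(−i(2w − 1))`. [cite: Dobner2021, §1 and §2 eq. for ξ^F_t] -/
def xiDeformed (t : ℝ) (w : ℂ) : ℂ :=
  8 * deBruijnH t (-I * (2 * w - 1))

/-- Unfolding lemma for `ξ_t`. [folklore] -/
theorem xiDeformed_eq (t : ℝ) (w : ℂ) : xiDeformed t w = 8 * deBruijnH t (-I * (2 * w - 1)) := rfl

/-- At `t = 0`, `ξ_0 = ξ` (given `H_0(z) = ξ(½ + iz/2)/8`, the named fact `Literature.NumberTheory.LFunctions.deBruijnH_zero_eq`,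
discharged in `DeBruijnHZeroProofs.lean`). [cite: Dobner2021, §1] -/
theorem xiDeformed_zero_eq (h : deBruijnH_zero_eq) (w : ℂ) : xiDeformed 0 w = riemannXi w := by
  rw [xiDeformed, h]
  have : (1 / 2 + I * (-I * (2 * w - 1)) / 2 : ℂ) = w := by
    rw [show I * (-I * (2 * w - 1)) = -(I * I) * (2 * w - 1) by ring, Complex.I_mul_I]
    ring
  rw [this]
  ring

/-- `ξ_t(w) = 0 ↔ H_t(−i(2w−1)) = 0`, and `Re w = ½ ↔ −i(2w − 1)` is real: zeros of `ξ_t` off the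
critical line are exactly zeros of `H_t` off the real axis. [folklore] -/
theorem xiDeformed_eq_zero_iff (t : ℝ) (w : ℂ) :
    xiDeformed t w = 0 ↔ deBruijnH t (-I * (2 * w - 1)) = 0 := by
  rw [xiDeformed, mul_eq_zero, or_iff_right (by norm_num)]

/-- The imaginary part of `−i(2w − 1)` is `1 − 2 Re w`. [folklore] -/
theorem im_neg_I_mul (w : ℂ) : (-I * (2 * w - 1)).im = 1 - 2 * w.re := by
  simp [mul_im]

/-! ## Regularity of `Γ_ℝ` and `γ` off the poles (shared API)

The poles of `Γ_ℝ(s) = π^{-s/2} Γ(s/2)` are `s = 0, −2, −4, …`; the lemmas below are the light-weight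
shared home (requested in review) of the differentiability of `Γ_ℝ` and `γ` away from them, used by
`DobnerNewmanProofs.lean` (open upper half-plane) and `DobnerSteepestDescent.lean` (right
half-plane). -/

/-- `s/2` is not a non-positive integer when `Re s > 0` or `Im s ≠ 0`. [folklore] -/
theorem half_ne_neg_nat_of_re_pos_or_im_ne_zero {s : ℂ} (hs : 0 < s.re ∨ s.im ≠ 0) (m : ℕ) :
    s / 2 ≠ -m := by
  intro h
  rcases hs with hs | hs
  · have := congrArg Complex.re h
    simp at this
    linarith [m.cast_nonneg (α := ℝ)]
  · have := congrArg Complex.im h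
    simp at this
    exact hs this

/-- `Γ_ℝ` is differentiable at every `s` with `Re s > 0` or `Im s ≠ 0` (i.e. off the closed
negative real axis, which contains its poles `0, −2, −4, …`). [folklore] -/
theorem differentiableAt_Gammaℝ_of_re_pos_or_im_ne_zero {s : ℂ} (hs : 0 < s.re ∨ s.im ≠ 0) :
    DifferentiableAt ℂ Gammaℝ s := by
  have h1 : DifferentiableAt ℂ (fun s : ℂ ↦ (Real.pi : ℂ) ^ (-s / 2)) s := by
    refine DifferentiableAt.const_cpow (by fun_prop) (Or.inl ?_)
    exact_mod_cast Real.pi_ne_zero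
  have h2 : DifferentiableAt ℂ (fun s : ℂ ↦ Complex.Gamma (s / 2)) s :=
    (differentiableAt_Gamma (s / 2) (half_ne_neg_nat_of_re_pos_or_im_ne_zero hs)).comp s
      (by fun_prop)
  have : Gammaℝ = fun s : ℂ ↦ (Real.pi : ℂ) ^ (-s / 2) * Complex.Gamma (s / 2) := by
    funext s; rw [Gammaℝ_def]
  rw [this]
  exact h1.mul h2

/-- `γ = ½ s(s−1) Γ_ℝ` is differentiable at every `s` with `Re s > 0` or `Im s ≠ 0`. [folklore] -/
theorem differentiableAt_xiGammaFactor {s : ℂ} (hs : 0 < s.re ∨ s.im ≠ 0) :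
    DifferentiableAt ℂ xiGammaFactor s := by
  unfold xiGammaFactor
  exact ((differentiableAt_id.mul (differentiableAt_id.sub_const 1)).div_const 2).mul
    (differentiableAt_Gammaℝ_of_re_pos_or_im_ne_zero hs)

/-- `u ↦ γ(J + iu)` is continuous on `ℝ` when `Re J > 0`. [folklore] -/
theorem continuous_xiGammaFactor_vertical {J : ℂ} (hJ : 0 < J.re) :
    Continuous fun u : ℝ ↦ xiGammaFactor (J + u * I) := by
  refine continuous_iff_continuousAt.2 fun u ↦ ?_
  have h : DifferentiableAt ℂ xiGammaFactor (J + u * I) :=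
    differentiableAt_xiGammaFactor (Or.inl (by simpa using hJ))
  exact ContinuousAt.comp (f := fun u : ℝ ↦ J + u * I) (g := xiGammaFactor) h.continuousAt
    (by fun_prop)

/-- `γ(s) ≠ 0` when `Im s ≠ 0` (`s ≠ 0, 1` and `Γ_ℝ` has no zeros). [folklore] -/
theorem xiGammaFactor_ne_zero_of_im_ne_zero {s : ℂ} (hs : s.im ≠ 0) : xiGammaFactor s ≠ 0 := by
  have hs0 : s ≠ 0 := fun h ↦ by simp [h] at hs
  have hs1 : s ≠ 1 := fun h ↦ by simp [h] at hs
  have hG : Gammaℝ s ≠ 0 := by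
    intro h
    obtain ⟨n, rfl⟩ := Gammaℝ_eq_zero_iff.1 h
    simp at hs
  rw [xiGammaFactor]
  exact mul_ne_zero (div_ne_zero (mul_ne_zero hs0 (sub_ne_zero.2 hs1)) two_ne_zero) hG

/-! ## Named facts: Dobner's Thm. 4 (qualitative), Bohr's theorem, Dobner's Lemma 3 -/

/-- NAMED FACT (**Dobner 2021, Thm. 4, qualitative version** — the display following Thm. 4: "if
`t < 0`, `V` is some vertical strip, and `s = x + iy ∈ V` with `y` sufficiently large, then
`ξ_t(J_t(s)) = γ_t(s)(F_t(s) + o_{y→∞}(1))` where the decay of the error term is uniform in `x`";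
here `F = ζ`, `F_t = ζ_t`). Rendered: for `t < 0`, a strip `a ≤ Re s ≤ b` and `ε > 0` there is
`y₀` with `‖ξ_t(J_t(s)) − γ_t(s) ζ_t(s)‖ ≤ ε ‖γ_t(s)‖` whenever `a ≤ Re s ≤ b`, `Im s ≥ y₀`. (The
theorem proper gives the rate `O(y^{-1/5} e^{(10/|t|) min(x,−2)²})` for `|x| ≤ C y^{1/4}`,
`|t| ≤ C`; proved in §4 of the source by the method of steepest descent and Stirling's formula.)
Users take `(h : dobner_xiDeformed_approx)`. [cite: Dobner2021, Thm. 4] -/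
def dobner_xiDeformed_approx : Prop :=
  ∀ t : ℝ, t < 0 → ∀ a b : ℝ, a ≤ b → ∀ ε : ℝ, 0 < ε → ∃ y₀ : ℝ, ∀ s : ℂ,
    a ≤ s.re → s.re ≤ b → y₀ ≤ s.im →
      ‖xiDeformed t (dobnerJ t s) - dobnerGammaT t s * zetaDeformed t s‖ ≤ ε * ‖dobnerGammaT t s‖

/-- NAMED FACT (**H. Bohr 1922, Satz 1**, in the form of **Dobner 2021, Thm. 5**): let
`G(s) = Σ b_n n^{-s}` be absolutely convergent for `Re s > σ`. For every `ε > 0` and real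
`σ < α < β` there is a sequence of shifts `0 < τ_1 < τ_2 < ⋯` with `liminf (τ_{m+1} − τ_m) > 0`
and `limsup τ_m/m < ∞` such that `|G(s) − G(s + iτ_m)| < ε` for all `m` and all `α ≤ Re s ≤ β`.
Rendered with `LSeries b`, `LSeries.abscissaOfAbsConv b < α`, `StrictMono τ`, `0 < τ 0`, and the
two growth conditions as "eventually `τ_{m+1} − τ_m ≥ δ`" (`δ > 0`) and "`τ_m ≤ C (m + 1)` for all
`m`". Users take `(h : bohr_almost_periodic)`. [cite: BohrMA1922, Satz 1] [cite: Dobner2021, Thm. 5] -/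
def bohr_almost_periodic : Prop :=
  ∀ (b : ℕ → ℂ) (α β ε : ℝ), LSeries.abscissaOfAbsConv b < α → α < β → 0 < ε →
    ∃ τ : ℕ → ℝ, StrictMono τ ∧ 0 < τ 0 ∧
      (∃ δ : ℝ, 0 < δ ∧ ∀ᶠ m in atTop, δ ≤ τ (m + 1) - τ m) ∧
      (∃ C : ℝ, ∀ m : ℕ, τ m ≤ C * (m + 1)) ∧
      ∀ (m : ℕ) (s : ℂ), α ≤ s.re → s.re ≤ β → ‖LSeries b s - LSeries b (s + τ m * I)‖ < ε

/-- NAMED FACT (**Dobner 2021, Lemma 3**: "For any `t < 0`, `F_t` has a zero"; here `F = ζ`).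
The proof in §5 of the source: `F_t` is entire of order at most `2` and bounded on right
half-planes, so if zero-free it would be `e^{−λ s + ρ}` by Hadamard's factorisation theorem,
contradicting the uniqueness of coefficients of generalised Dirichlet series.
Users take `(h : dobner_zetaDeformed_exists_zero)`. [cite: Dobner2021, Lemma 3] -/
def dobner_zetaDeformed_exists_zero : Prop :=
  ∀ t : ℝ, t < 0 → ∃ s : ℂ, zetaDeformed t s = 0

end Literature.NumberTheory.LFunctions

end
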